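import Summits.BirchSwinnertonDyer.BirchSwinnertonDyer.Theorems.ByReductionTypeAtTwoAdditivePotMultConjATwoNarrowTwo469Parity
import Summits.BirchSwinnertonDyer.BirchSwinnertonDyer.Theorems.ByReductionTypeAtTwoAdditivePotMultConjATwoNarrowTwo469SignsWA1
import Summits.BirchSwinnertonDyer.BirchSwinnertonDyer.Theorems.ByReductionTypeAtTwoAdditivePotMultConjATwoNarrowTwo469SignsWA2
import Summits.BirchSwinnertonDyer.BirchSwinnertonDyer.Theorems.ByReductionTypeAtTwoAdditivePotMultConjATwoNarrowTwo469SignsWB1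
import Summits.BirchSwinnertonDyer.BirchSwinnertonDyer.Theorems.ByReductionTypeAtTwoAdditivePotMultConjATwoNarrowTwo469SignsWB2
import Summits.BirchSwinnertonDyer.BirchSwinnertonDyer.Theorems.ByReductionTypeAtTwoAdditivePotMultConjATwoNarrowTwo469SignsWC1
import Summits.BirchSwinnertonDyer.BirchSwinnertonDyer.Theorems.ByReductionTypeAtTwoAdditivePotMultConjATwoNarrowTwo469SignsWC2
import Literature.NumberTheory.NumberFields.TotPosUnitsModSqMonotone
import HarnessLib

/-!
# C4″ `AdditivePotMultOverKAtTwo` (item stmt-BirchSwinnertonDyer-22618), the (I1M′) input of the upper half on the `0 < Δ` rows: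
# LAYER-TWO NARROW CERTIFICATE `d = 469` (S₃-CLOSURE ROAD), part UNITS — nine units of `ℤ[θ, ω, e] = 𝓞 A₂` with an invertible `10 × 10` sign minor (with `−1`),
# and the NARROW RANK CERTIFICATE `[Cl⁺(A₂) : Cl⁺(A₂)²] = [Cl⁺(A₁) : Cl⁺(A₁)²] = 4` by the Edgar–Mollin–Peterson door `a = 2`, `b = 10` (KERNEL; rows 210112ek1)

Cell `bsd-2adic`, rung K4, seat `bsd-2adic-k4-w3` GEN 15 (explicit unit of director-bsd g16 (309)(7); `--supports stmt-BirchSwinnertonDyer-22618`).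
HONEST FRAMING (D-0036/D-0054/D-0152): THEOREMS ONLY (no definition, no named fact, no `sorry`, no instance). The series `…NarrowTwo469{Class, Field,
Dyadic, TotPos, Integers, Parity, SignsW…, Units, Row…}` is the PQ ROAD (residue degree `f(𝔮) = 2`) of the layer-two narrow certificate: in the totally real cubic
`2`-torsion field `E` of discriminant `469` (`X³ + (-1)X² + (-5)X + (4)`, odd discriminant) `2 = u·π_𝔭·π_𝔮` is UNRAMIFIED with `f(𝔭) = 1`, `f(𝔮) = 2`; in
`A₁ = ℚ(θ) ⊔ ℚ_1 = E(√2)` both ramify: `π_𝔭 = v₁π²` (`|N(π)| = 2`) and `π_𝔮 = v₂η²` (`|N(η)| = 4`, `𝓞/(η) ≅ 𝔽₄` by the tree's `prime_of_absNorm_span_eq_four`),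
`2 = V·π²η²`; `h(A₁)` odd by k4-w1's one-bit door (two primes above `2`, a `2`-adic non-norm unit of `E`), `h(A₂)` odd by genus theory for `A₂/A₁` (two ramified primes,
ONE dyadic non-norm unit certified at `π` after multiplication by a norm), `#(U⁺/U²)(A₁) ≥ 2` from one totally positive unit with a residue witness through `A₂`
(k4-w2's `exists_ringHom_ringOfIntegers_sup_layer_two_zmod'`), ELEVEN sign-independent units of `A₂ = E(√(2+√2))` (with `−1`; `𝓞 A₂ = 𝓞 A₁[e]`), k4-w2's
Edgar–Mollin–Peterson door `a = 1`, `b = 11`, cruxlead-19573-w2's rung `m = 1`; C4″ census rows 210112ek1 (eng-2 CERT-ADD-POTMULT-POS81-AB-E2: `rank₂ Cl⁺ = [0,1,1]`,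
`h = 1` at layers `0,1,2`, `2 = 𝔭𝔮` with `f(𝔮) = 2` — letter NARROW-EQUAL12, instrument grade `grh`; here KERNEL). All certificates were found by the seat's
exact-arithmetic tools (`k4w3/gen15/tools`: `s3explore_pq`, `certpq`, GEN 13/14 `nf12/unitlib`) and are CHECKED HERE by the kernel. Statement (A) is NOT BSD: BSD₂ for
these curves is not proved; C4″ / (I1M′) stay research-open; nothing booked; no row of 22618 changes tier (pen RC-490 (4)); BSD is not proved by any of this.

References: [CoatesSujatha2005] Conj. A, Thm. 3.4; [Fukuda1994] Thm. 1 (2); [EdgarMollinPeterson1986] Thm. 2.1; [FrohlichTaylor1990] Ch. V §1 (1.8)–(1.13);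
[Lang1990] Ch. 13 §4 Lemma 4.1; [Washington1997] §13.1, Prop. 13.2; [Cohen1993] §4.1.3, §4.8.2, §6.3; [Marcus1977] Ch. 3 Thm. 27, Ch. 5 Thm. 22; [Omeara1963] §63.
-/

set_option autoImplicit false
-- sibling precedent: the directory name repeats the summit name
set_option linter.dupNamespace false

noncomputable section

open scoped Classical IntermediateField NumberField nonZeroDivisors Polynomial

namespace Summit.BirchSwinnertonDyer.BirchSwinnertonDyer.Theorems.AddKatoTwo

open Polynomial IsDedekindDomain NumberField Field IntermediateField
  Literature.NumberTheory.EllipticCurves Literature.NumberTheory.EllipticCurves.ZpExtension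
  Literature.NumberTheory.IwasawaTheory Literature.NumberTheory.NumberFields
  Literature.NumberTheory.GaloisRepresentations Literature.Geometry.Kaehler.ComplexTorus

variable {θ : AlgebraicClosure ℚ}

/-- **The inverses of the nine units `e₁ … e₉` of `ℤ[θ, ω, p]`** (`4 - 5 * θ - θ ^ 2 + θ ^ 3 = 0`, `ω² = (0) * ω + (2)`, `p² = 2 - ω`),
in any commutative ring (found by the seat's unit search in the `2`-maximal order of `A₂`; KERNEL). [folklore] [cite: Cohen1993, §6.3] -/
theorem layer_two_unit_ids_d469 {R : Type*} [CommRing R] (bB xB pB : R) (Rb : 4 - 5 * bB - bB ^ 2 + bB ^ 3 = 0)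
    (Rx : xB ^ 2 = (0) * xB + (2)) (Rp : pB ^ 2 = 2 - xB) :
    (-1 - pB + xB) * (-1 - pB - xB * pB) = 1 ∧
    (-1 + pB + xB) * (-1 + pB + xB * pB) = 1 ∧
    (-1 - pB) * (-1 + pB - xB + xB * pB) = 1 ∧
    (-1 + bB) * (-5 + bB ^ 2) = 1 ∧
    (-1 + xB + bB) * (5 - 3 * xB - 4 * bB + 3 * bB * xB - 3 * bB ^ 2 + 2 * bB ^ 2 * xB) = 1 ∧
    (-1 - xB + bB) * (5 + 3 * xB - 4 * bB - 3 * bB * xB - 3 * bB ^ 2 - 2 * bB ^ 2 * xB) = 1 ∧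
    (-5 + pB + 5 * xB + xB * pB + bB ^ 2 - bB ^ 2 * xB) * (3 + 7 * pB - 18 * xB - 25 * bB + 16 * xB * pB + 14 * bB * pB + 17 * bB * xB + 10 * bB ^ 2 - 9 * bB * xB * pB - 7 * bB ^ 2 * pB - 4 * bB ^ 2 * xB + bB ^ 2 * xB * pB) = 1 ∧
    (-5 - pB - 5 * xB + bB ^ 2 + bB ^ 2 * xB) * (3 - 25 * pB + 18 * xB - 25 * bB - 9 * xB * pB + 32 * bB * pB - 17 * bB * xB + 10 * bB ^ 2 + 23 * bB * xB * pB - 9 * bB ^ 2 * pB + 4 * bB ^ 2 * xB - 8 * bB ^ 2 * xB * pB) = 1 ∧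
    (1 + 2 * xB - bB + bB * pB - 2 * bB * xB + bB * xB * pB - bB ^ 2 * pB - bB ^ 2 * xB * pB) * (21 - 12 * pB - 14 * xB - 18 * bB + 8 * xB * pB + 10 * bB * pB + 13 * bB * xB - 13 * bB ^ 2 - 7 * bB * xB * pB + 7 * bB ^ 2 * pB + 9 * bB ^ 2 * xB - 5 * bB ^ 2 * xB * pB) = 1 ∧
    (1 - 2 * xB - bB + bB * pB + 2 * bB * xB - bB ^ 2 * pB) * (21 + 28 * pB + 14 * xB - 18 * bB + 20 * xB * pB - 24 * bB * pB - 13 * bB * xB - 13 * bB ^ 2 - 17 * bB * xB * pB - 17 * bB ^ 2 * pB - 9 * bB ^ 2 * xB - 12 * bB ^ 2 * xB * pB) = 1 := by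
  refine ⟨?_, ?_, ?_, ?_, ?_, ?_, ?_, ?_, ?_, ?_⟩
  · linear_combination ((0 : R)) * Rb + ((-1 : R) + (-1 : R) * pB) * Rx + ((1 : R) + (1 : R) * xB) * Rp
  · linear_combination ((0 : R)) * Rb + ((-1 : R) + (1 : R) * pB) * Rx + ((1 : R) + (1 : R) * xB) * Rp
  · linear_combination ((0 : R)) * Rb + ((1 : R)) * Rx + ((-1 : R) + (-1 : R) * xB) * Rp
  · linear_combination ((1 : R)) * Rb + ((0 : R)) * Rx + ((0 : R)) * Rp
  · linear_combination ((-3 : R) + (2 : R) * xB) * Rb + ((-3 : R) + (3 : R) * bB + (2 : R) * bB ^ 2) * Rx + ((0 : R)) * Rp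
  · linear_combination ((-3 : R) + (-2 : R) * xB) * Rb + ((-3 : R) + (3 : R) * bB + (2 : R) * bB ^ 2) * Rx + ((0 : R)) * Rp
  · linear_combination ((-41 : R) + (23 : R) * pB + (28 : R) * xB + (18 : R) * bB + (-15 : R) * xB * pB + (-9 : R) * bB * pB + (-14 : R) * bB * xB + (8 : R) * bB * xB * pB) * Rb + ((-81 : R) + (62 : R) * pB + (-16 : R) * xB + (62 : R) * bB + (-28 : R) * bB * pB + (9 : R) * bB * xB + (6 : R) * bB ^ 2 + (-15 : R) * bB ^ 2 * pB + (-1 : R) * bB ^ 2 * xB + (-17 : R) * bB ^ 3 + (9 : R) * bB ^ 3 * pB + (4 : R) * bB ^ 4 + (-1 : R) * bB ^ 4 * pB) * Rx + ((7 : R) + (23 : R) * xB + (14 : R) * bB + (16 : R) * xB ^ 2 + (5 : R) * bB * xB + (-7 : R) * bB ^ 2 + (-9 : R) * bB * xB ^ 2 + (-6 : R) * bB ^ 2 * xB + (1 : R) * bB ^ 2 * xB ^ 2) * Rp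
  · linear_combination ((-41 : R) + (53 : R) * pB + (-28 : R) * xB + (18 : R) * bB + (38 : R) * xB * pB + (-25 : R) * bB * pB + (14 : R) * bB * xB + (-17 : R) * bB * xB * pB) * Rb + ((-99 : R) + (45 : R) * pB + (108 : R) * bB + (-115 : R) * bB * pB + (-10 : R) * bB ^ 2 + (31 : R) * bB ^ 2 * pB + (-17 : R) * bB ^ 3 + (23 : R) * bB ^ 3 * pB + (4 : R) * bB ^ 4 + (-8 : R) * bB ^ 4 * pB) * Rx + ((25 : R) + (9 : R) * xB + (-32 : R) * bB + (-23 : R) * bB * xB + (9 : R) * bB ^ 2 + (8 : R) * bB ^ 2 * xB) * Rp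
  · linear_combination ((-9 : R) + (5 : R) * pB + (7 : R) * xB + (10 : R) * bB + (-4 : R) * xB * pB + (-5 : R) * bB * pB + (-7 : R) * bB * xB + (4 : R) * bB * xB * pB) * Rb + ((-28 : R) + (16 : R) * pB + (74 : R) * bB + (-44 : R) * bB * pB + (-8 : R) * bB * xB + (-45 : R) * bB ^ 2 + (31 : R) * bB ^ 2 * pB + (15 : R) * bB ^ 2 * xB + (-13 : R) * bB ^ 3 + (6 : R) * bB ^ 3 * pB + (-2 : R) * bB ^ 3 * xB + (12 : R) * bB ^ 4 + (-9 : R) * bB ^ 4 * pB + (-5 : R) * bB ^ 4 * xB) * Rx + ((-12 : R) * bB + (-4 : R) * bB * xB + (22 : R) * bB ^ 2 + (8 : R) * bB * xB ^ 2 + (7 : R) * bB ^ 2 * xB + (-3 : R) * bB ^ 3 + (-15 : R) * bB ^ 2 * xB ^ 2 + (-1 : R) * bB ^ 3 * xB + (-7 : R) * bB ^ 4 + (2 : R) * bB ^ 3 * xB ^ 2 + (-2 : R) * bB ^ 4 * xB + (5 : R) * bB ^ 4 * xB ^ 2) * Rp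
  · linear_combination ((-9 : R) + (-13 : R) * pB + (-7 : R) * xB + (10 : R) * bB + (-9 : R) * xB * pB + (13 : R) * bB * pB + (7 : R) * bB * xB + (9 : R) * bB * xB * pB) * Rb + ((-28 : R) + (-40 : R) * pB + (34 : R) * bB + (74 : R) * bB * pB + (29 : R) * bB ^ 2 + (-10 : R) * bB ^ 2 * pB + (-23 : R) * bB ^ 3 + (-24 : R) * bB ^ 3 * pB + (-12 : R) * bB ^ 4) * Rx + ((28 : R) * bB + (20 : R) * bB * xB + (-52 : R) * bB ^ 2 + (-37 : R) * bB ^ 2 * xB + (7 : R) * bB ^ 3 + (5 : R) * bB ^ 3 * xB + (17 : R) * bB ^ 4 + (12 : R) * bB ^ 4 * xB) * Rp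

set_option linter.unusedSimpArgs false in
set_option linter.unusedSimpArgs false in
set_option maxHeartbeats 16000000 in
set_option maxRecDepth 100000 in
/-- **`[Cl⁺(A₂) : Cl⁺(A₂)²] = [Cl⁺(A₁) : Cl⁺(A₁)²] = 4`** for `A₁ = ℚ(θ) ⊔ ℚ_1`, `A₂ = ℚ(θ) ⊔ ℚ_2`, `θ³ + (-1)θ² + (-5)θ + (4) = 0` (`d = 469 = 8m²`, S₃-closure road) — the narrow rank certificate of the
C4″ census rows 210112ek1 at the rung `m = 1` (`rank₂ Cl⁺ = 2` at both layers; `h(A₁)`, `h(A₂)` odd, `#(U⁺/U²)(A₁) ≥ 4`, ten sign-independent units of `A₂` with `−1`,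
Edgar–Mollin–Peterson `a = 2`, `b = 10`), KERNEL. [cite: EdgarMollinPeterson1986, Thm. 2.1, p. 34]
[cite: FrohlichTaylor1990, Ch. V §1 (1.8)–(1.13), pp. 163–164] [cite: Washington1997, §13.1] -/
theorem index_range_pow_two_narrowClassGroup_adjoin_sup_layer_two_d469
    (hθ : aeval θ (Cubic.toPoly ⟨1, ((-1 : ℤ) : ℚ), ((-5 : ℤ) : ℚ), ((4 : ℤ) : ℚ)⟩) = 0) :
    haveI : FiniteDimensional ℚ ↥ℚ⟮θ⟯ :=
      IntermediateField.adjoin.finiteDimensional ⟨_, Cubic.monic_of_a_eq_one', by rwa [← aeval_def]⟩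
    haveI : FiniteDimensional ℚ ↥((CyclotomicZp.zpExtension 2).layer 1) := (CyclotomicZp.zpExtension 2).finiteDimensional_layer_holds 1
    haveI : FiniteDimensional ℚ ↥((CyclotomicZp.zpExtension 2).layer 2) := (CyclotomicZp.zpExtension 2).finiteDimensional_layer_holds 2
    haveI : NumberField ↥(ℚ⟮θ⟯ ⊔ (CyclotomicZp.zpExtension 2).layer 1) := NumberField.mk
    haveI : NumberField ↥(ℚ⟮θ⟯ ⊔ (CyclotomicZp.zpExtension 2).layer 2) := NumberField.mk
    (powMonoidHom (α := NarrowClassGroup ↥(ℚ⟮θ⟯ ⊔ (CyclotomicZp.zpExtension 2).layer 2)) 2).range.index = (powMonoidHom (α := NarrowClassGroup ↥(ℚ⟮θ⟯ ⊔ (CyclotomicZp.zpExtension 2).layer 1)) 2).range.index ∧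
      (powMonoidHom (α := NarrowClassGroup ↥(ℚ⟮θ⟯ ⊔ (CyclotomicZp.zpExtension 2).layer 1)) 2).range.index = 2 := by
  haveI : FiniteDimensional ℚ ↥ℚ⟮θ⟯ :=
    IntermediateField.adjoin.finiteDimensional ⟨_, Cubic.monic_of_a_eq_one', by rwa [← aeval_def]⟩
  haveI : FiniteDimensional ℚ ↥((CyclotomicZp.zpExtension 2).layer 1) := (CyclotomicZp.zpExtension 2).finiteDimensional_layer_holds 1
  haveI : FiniteDimensional ℚ ↥((CyclotomicZp.zpExtension 2).layer 2) := (CyclotomicZp.zpExtension 2).finiteDimensional_layer_holds 2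
  haveI : NumberField ↥ℚ⟮θ⟯ := NumberField.mk
  haveI : NumberField ↥(ℚ⟮θ⟯ ⊔ (CyclotomicZp.zpExtension 2).layer 1) := NumberField.mk
  haveI : NumberField ↥(ℚ⟮θ⟯ ⊔ (CyclotomicZp.zpExtension 2).layer 2) := NumberField.mk
  obtain ⟨hreal2, hfin2, h3⟩ := layer_two_basics irreducible_cubic_d469p hθ (isTotallyReal_adjoin_d469p hθ)
  haveI := hreal2
  -- a root `e ∈ ℚ_2` of `Ψ₂`
  obtain ⟨e, he, -, he4⟩ := CyclotomicZp.exists_mem_layer_two_quartic_zpExtension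
  have he0 : (fun x : AlgebraicClosure ℚ => x ^ 2 - 2)^[2] e = 0 := by
    simp only [Function.iterate_succ, Function.iterate_zero, Function.comp_apply, id_eq]
    linear_combination he4
  have hK2 : ℚ⟮θ⟯ ≤ ℚ⟮θ⟯ ⊔ (CyclotomicZp.zpExtension 2).layer 2 := le_sup_left
  have h12 : ℚ⟮θ⟯ ⊔ (CyclotomicZp.zpExtension 2).layer 1 ≤ ℚ⟮θ⟯ ⊔ (CyclotomicZp.zpExtension 2).layer 2 :=
    sup_le_sup_left ((CyclotomicZp.zpExtension 2).layer_mono (by norm_num : 1 ≤ 2)) _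
  have heA : e ∈ ℚ⟮θ⟯ ⊔ (CyclotomicZp.zpExtension 2).layer 2 := (le_sup_right : (CyclotomicZp.zpExtension 2).layer 2 ≤ _) he
  set e'' : ↥(ℚ⟮θ⟯ ⊔ (CyclotomicZp.zpExtension 2).layer 2) := ⟨e, heA⟩ with he''def
  set θ'' : ↥(ℚ⟮θ⟯ ⊔ (CyclotomicZp.zpExtension 2).layer 2) := inclusion hK2 (AdjoinSimple.gen ℚ θ) with hθ''def
  -- located roots of the cubic and of `Ψ₂`
  obtain ⟨ρ₀, ρ₁, ρ₂, x₀, x₁, x₂, hρ₀, hρ₁, hρ₂, hl₀, hu₀, hl₁, hu₁, hl₂, hu₂⟩ := exists_three_ringHom_adjoin_d469p hθ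
  obtain ⟨b, hbθ, hb⟩ := exists_ringOfIntegers_cubic_root (p := -1) (q := -5) (r := 4) hθ
  have hgenrel : 4 - 5 * AdjoinSimple.gen ℚ θ - AdjoinSimple.gen ℚ θ ^ 2 + AdjoinSimple.gen ℚ θ ^ 3 = 0 := by
    have hbgen : algebraMap (𝓞 ↥ℚ⟮θ⟯) ↥ℚ⟮θ⟯ b = AdjoinSimple.gen ℚ θ := Subtype.ext hbθ
    have h := congrArg (algebraMap (𝓞 ↥ℚ⟮θ⟯) ↥ℚ⟮θ⟯) hb
    simp only [map_add, map_mul, map_pow, map_intCast, map_zero, hbgen] at h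
    push_cast at h
    linear_combination h
  have hxrel : ∀ (ρ : ↥ℚ⟮θ⟯ →+* ℝ) (x : ℝ), ρ (AdjoinSimple.gen ℚ θ) = x → 4 - 5 * x - x ^ 2 + x ^ 3 = 0 := by
    intro ρ x hx
    have h := congrArg ρ hgenrel
    simp only [map_add, map_sub, map_mul, map_pow, map_ofNat, map_zero, map_neg, map_one, hx] at h; exact h
  have hx₀ := hxrel ρ₀ x₀ hρ₀
  have hx₁ := hxrel ρ₁ x₁ hρ₁
  have hx₂ := hxrel ρ₂ x₂ hρ₂
  have hs2sq : Real.sqrt 2 ^ 2 = 2 := Real.sq_sqrt (by norm_num)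
  have hs2u : Real.sqrt 2 < 2 := (Real.sqrt_lt' (by norm_num)).mpr (by norm_num)
  have hZ1sq : Real.sqrt (2 + Real.sqrt 2) ^ 2 = 2 + Real.sqrt 2 := Real.sq_sqrt (by positivity)
  have hZ2sq : Real.sqrt (2 - Real.sqrt 2) ^ 2 = 2 - Real.sqrt 2 := Real.sq_sqrt (by linarith)
  have hrZ1p : (fun x : ℝ => x ^ 2 - 2)^[2] (Real.sqrt (2 + Real.sqrt 2)) = 0 := by
    simp only [Function.iterate_succ, Function.iterate_zero, Function.comp_apply, id_eq]; rw [hZ1sq]; linear_combination hs2sq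
  have hrZ1m : (fun x : ℝ => x ^ 2 - 2)^[2] (-Real.sqrt (2 + Real.sqrt 2)) = 0 := by
    simp only [Function.iterate_succ, Function.iterate_zero, Function.comp_apply, id_eq]; rw [neg_sq, hZ1sq]; linear_combination hs2sq
  have hrZ2p : (fun x : ℝ => x ^ 2 - 2)^[2] (Real.sqrt (2 - Real.sqrt 2)) = 0 := by
    simp only [Function.iterate_succ, Function.iterate_zero, Function.comp_apply, id_eq]; rw [hZ2sq]; linear_combination hs2sq
  have hrZ2m : (fun x : ℝ => x ^ 2 - 2)^[2] (-Real.sqrt (2 - Real.sqrt 2)) = 0 := by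
    simp only [Function.iterate_succ, Function.iterate_zero, Function.comp_apply, id_eq]; rw [neg_sq, hZ2sq]; linear_combination hs2sq
  -- the integers `b`, `ξ`, `p` and the units
  obtain ⟨bB, xB, pB, hbBv, hξBv, hpBv, RbB, RxB, RpB⟩ := layer_two_integers_d469 hθ he he0
  have hbB' : algebraMap (𝓞 ↥(ℚ⟮θ⟯ ⊔ (CyclotomicZp.zpExtension 2).layer 2)) ↥(ℚ⟮θ⟯ ⊔ (CyclotomicZp.zpExtension 2).layer 2) bB = θ'' := hbBv
  have hξB' : algebraMap (𝓞 ↥(ℚ⟮θ⟯ ⊔ (CyclotomicZp.zpExtension 2).layer 2)) ↥(ℚ⟮θ⟯ ⊔ (CyclotomicZp.zpExtension 2).layer 2) xB = ((0) + (e'' ^ 2 - 2) * (-1)) := hξBv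
  have hpB' : algebraMap (𝓞 ↥(ℚ⟮θ⟯ ⊔ (CyclotomicZp.zpExtension 2).layer 2)) ↥(ℚ⟮θ⟯ ⊔ (CyclotomicZp.zpExtension 2).layer 2) pB = (e'' * ((1) + (e'' ^ 2 - 2) * (0))) := hpBv
  obtain ⟨hid1, hid2, hid3, hid4, hid5, hid6, hid7, hid8, hid9, hid10⟩ := layer_two_unit_ids_d469 bB xB pB RbB RxB RpB
  set e₀ : (𝓞 ↥(ℚ⟮θ⟯ ⊔ (CyclotomicZp.zpExtension 2).layer 2))ˣ := -1 with he₀def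
  set e₁ : (𝓞 ↥(ℚ⟮θ⟯ ⊔ (CyclotomicZp.zpExtension 2).layer 2))ˣ := Units.mkOfMulEqOne _ _ hid1 with he₁def
  set e₂ : (𝓞 ↥(ℚ⟮θ⟯ ⊔ (CyclotomicZp.zpExtension 2).layer 2))ˣ := Units.mkOfMulEqOne _ _ hid2 with he₂def
  set e₃ : (𝓞 ↥(ℚ⟮θ⟯ ⊔ (CyclotomicZp.zpExtension 2).layer 2))ˣ := Units.mkOfMulEqOne _ _ hid3 with he₃def
  set e₄ : (𝓞 ↥(ℚ⟮θ⟯ ⊔ (CyclotomicZp.zpExtension 2).layer 2))ˣ := Units.mkOfMulEqOne _ _ hid4 with he₄def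
  set e₅ : (𝓞 ↥(ℚ⟮θ⟯ ⊔ (CyclotomicZp.zpExtension 2).layer 2))ˣ := Units.mkOfMulEqOne _ _ hid5 with he₅def
  set e₆ : (𝓞 ↥(ℚ⟮θ⟯ ⊔ (CyclotomicZp.zpExtension 2).layer 2))ˣ := Units.mkOfMulEqOne _ _ hid6 with he₆def
  set e₇ : (𝓞 ↥(ℚ⟮θ⟯ ⊔ (CyclotomicZp.zpExtension 2).layer 2))ˣ := Units.mkOfMulEqOne _ _ hid7 with he₇def
  set e₈ : (𝓞 ↥(ℚ⟮θ⟯ ⊔ (CyclotomicZp.zpExtension 2).layer 2))ˣ := Units.mkOfMulEqOne _ _ hid8 with he₈def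
  set e₉ : (𝓞 ↥(ℚ⟮θ⟯ ⊔ (CyclotomicZp.zpExtension 2).layer 2))ˣ := Units.mkOfMulEqOne _ _ hid9 with he₉def
  set e₁₀ : (𝓞 ↥(ℚ⟮θ⟯ ⊔ (CyclotomicZp.zpExtension 2).layer 2))ˣ := Units.mkOfMulEqOne _ _ hid10 with he₁₀def
  have hve₁ : ((e₁ : 𝓞 ↥(ℚ⟮θ⟯ ⊔ (CyclotomicZp.zpExtension 2).layer 2)) : ↥(ℚ⟮θ⟯ ⊔ (CyclotomicZp.zpExtension 2).layer 2)) = (-1 - (algebraMap (𝓞 ↥(ℚ⟮θ⟯ ⊔ (CyclotomicZp.zpExtension 2).layer 2)) ↥(ℚ⟮θ⟯ ⊔ (CyclotomicZp.zpExtension 2).layer 2) pB) + (algebraMap (𝓞 ↥(ℚ⟮θ⟯ ⊔ (CyclotomicZp.zpExtension 2).layer 2)) ↥(ℚ⟮θ⟯ ⊔ (CyclotomicZp.zpExtension 2).layer 2) xB)) := by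
    rw [he₁def, Units.val_mkOfMulEqOne, NumberField.RingOfIntegers.coe_eq_algebraMap]; simp only [map_add, map_sub, map_mul, map_pow, map_zero, map_neg, map_one, map_ofNat, hbB']
  have hve₂ : ((e₂ : 𝓞 ↥(ℚ⟮θ⟯ ⊔ (CyclotomicZp.zpExtension 2).layer 2)) : ↥(ℚ⟮θ⟯ ⊔ (CyclotomicZp.zpExtension 2).layer 2)) = (-1 + (algebraMap (𝓞 ↥(ℚ⟮θ⟯ ⊔ (CyclotomicZp.zpExtension 2).layer 2)) ↥(ℚ⟮θ⟯ ⊔ (CyclotomicZp.zpExtension 2).layer 2) pB) + (algebraMap (𝓞 ↥(ℚ⟮θ⟯ ⊔ (CyclotomicZp.zpExtension 2).layer 2)) ↥(ℚ⟮θ⟯ ⊔ (CyclotomicZp.zpExtension 2).layer 2) xB)) := by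
    rw [he₂def, Units.val_mkOfMulEqOne, NumberField.RingOfIntegers.coe_eq_algebraMap]; simp only [map_add, map_sub, map_mul, map_pow, map_zero, map_neg, map_one, map_ofNat, hbB']
  have hve₃ : ((e₃ : 𝓞 ↥(ℚ⟮θ⟯ ⊔ (CyclotomicZp.zpExtension 2).layer 2)) : ↥(ℚ⟮θ⟯ ⊔ (CyclotomicZp.zpExtension 2).layer 2)) = (-1 - (algebraMap (𝓞 ↥(ℚ⟮θ⟯ ⊔ (CyclotomicZp.zpExtension 2).layer 2)) ↥(ℚ⟮θ⟯ ⊔ (CyclotomicZp.zpExtension 2).layer 2) pB)) := by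
    rw [he₃def, Units.val_mkOfMulEqOne, NumberField.RingOfIntegers.coe_eq_algebraMap]; simp only [map_add, map_sub, map_mul, map_pow, map_zero, map_neg, map_one, map_ofNat, hbB']
  have hve₄ : ((e₄ : 𝓞 ↥(ℚ⟮θ⟯ ⊔ (CyclotomicZp.zpExtension 2).layer 2)) : ↥(ℚ⟮θ⟯ ⊔ (CyclotomicZp.zpExtension 2).layer 2)) = (-1 + θ'') := by
    rw [he₄def, Units.val_mkOfMulEqOne, NumberField.RingOfIntegers.coe_eq_algebraMap]; simp only [map_add, map_sub, map_mul, map_pow, map_zero, map_neg, map_one, map_ofNat, hbB']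
  have hve₅ : ((e₅ : 𝓞 ↥(ℚ⟮θ⟯ ⊔ (CyclotomicZp.zpExtension 2).layer 2)) : ↥(ℚ⟮θ⟯ ⊔ (CyclotomicZp.zpExtension 2).layer 2)) = (-1 + (algebraMap (𝓞 ↥(ℚ⟮θ⟯ ⊔ (CyclotomicZp.zpExtension 2).layer 2)) ↥(ℚ⟮θ⟯ ⊔ (CyclotomicZp.zpExtension 2).layer 2) xB) + θ'') := by
    rw [he₅def, Units.val_mkOfMulEqOne, NumberField.RingOfIntegers.coe_eq_algebraMap]; simp only [map_add, map_sub, map_mul, map_pow, map_zero, map_neg, map_one, map_ofNat, hbB']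
  have hve₆ : ((e₆ : 𝓞 ↥(ℚ⟮θ⟯ ⊔ (CyclotomicZp.zpExtension 2).layer 2)) : ↥(ℚ⟮θ⟯ ⊔ (CyclotomicZp.zpExtension 2).layer 2)) = (-1 - (algebraMap (𝓞 ↥(ℚ⟮θ⟯ ⊔ (CyclotomicZp.zpExtension 2).layer 2)) ↥(ℚ⟮θ⟯ ⊔ (CyclotomicZp.zpExtension 2).layer 2) xB) + θ'') := by
    rw [he₆def, Units.val_mkOfMulEqOne, NumberField.RingOfIntegers.coe_eq_algebraMap]; simp only [map_add, map_sub, map_mul, map_pow, map_zero, map_neg, map_one, map_ofNat, hbB']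
  have hve₇ : ((e₇ : 𝓞 ↥(ℚ⟮θ⟯ ⊔ (CyclotomicZp.zpExtension 2).layer 2)) : ↥(ℚ⟮θ⟯ ⊔ (CyclotomicZp.zpExtension 2).layer 2)) = (-5 + (algebraMap (𝓞 ↥(ℚ⟮θ⟯ ⊔ (CyclotomicZp.zpExtension 2).layer 2)) ↥(ℚ⟮θ⟯ ⊔ (CyclotomicZp.zpExtension 2).layer 2) pB) + 5 * (algebraMap (𝓞 ↥(ℚ⟮θ⟯ ⊔ (CyclotomicZp.zpExtension 2).layer 2)) ↥(ℚ⟮θ⟯ ⊔ (CyclotomicZp.zpExtension 2).layer 2) xB) + (algebraMap (𝓞 ↥(ℚ⟮θ⟯ ⊔ (CyclotomicZp.zpExtension 2).layer 2)) ↥(ℚ⟮θ⟯ ⊔ (CyclotomicZp.zpExtension 2).layer 2) xB) * (algebraMap (𝓞 ↥(ℚ⟮θ⟯ ⊔ (CyclotomicZp.zpExtension 2).layer 2)) ↥(ℚ⟮θ⟯ ⊔ (CyclotomicZp.zpExtension 2).layer 2) pB) + θ'' ^ 2 - θ'' ^ 2 * (algebraMap (𝓞 ↥(ℚ⟮θ⟯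 ⊔ (CyclotomicZp.zpExtension 2).layer 2)) ↥(ℚ⟮θ⟯ ⊔ (CyclotomicZp.zpExtension 2).layer 2) xB)) := by
    rw [he₇def, Units.val_mkOfMulEqOne, NumberField.RingOfIntegers.coe_eq_algebraMap]; simp only [map_add, map_sub, map_mul, map_pow, map_zero, map_neg, map_one, map_ofNat, hbB']
  have hve₈ : ((e₈ : 𝓞 ↥(ℚ⟮θ⟯ ⊔ (CyclotomicZp.zpExtension 2).layer 2)) : ↥(ℚ⟮θ⟯ ⊔ (CyclotomicZp.zpExtension 2).layer 2)) = (-5 - (algebraMap (𝓞 ↥(ℚ⟮θ⟯ ⊔ (CyclotomicZp.zpExtension 2).layer 2)) ↥(ℚ⟮θ⟯ ⊔ (CyclotomicZp.zpExtension 2).layer 2) pB) - 5 * (algebraMap (𝓞 ↥(ℚ⟮θ⟯ ⊔ (CyclotomicZp.zpExtension 2).layer 2)) ↥(ℚ⟮θ⟯ ⊔ (CyclotomicZp.zpExtension 2).layer 2) xB) + θ'' ^ 2 + θ'' ^ 2 * (algebraMap (𝓞 ↥(ℚ⟮θ⟯ ⊔ (CyclotomicZp.zpExtension 2).layer 2))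 ↥(ℚ⟮θ⟯ ⊔ (CyclotomicZp.zpExtension 2).layer 2) xB)) := by
    rw [he₈def, Units.val_mkOfMulEqOne, NumberField.RingOfIntegers.coe_eq_algebraMap]; simp only [map_add, map_sub, map_mul, map_pow, map_zero, map_neg, map_one, map_ofNat, hbB']
  have hve₉ : ((e₉ : 𝓞 ↥(ℚ⟮θ⟯ ⊔ (CyclotomicZp.zpExtension 2).layer 2)) : ↥(ℚ⟮θ⟯ ⊔ (CyclotomicZp.zpExtension 2).layer 2)) = (1 + 2 * (algebraMap (𝓞 ↥(ℚ⟮θ⟯ ⊔ (CyclotomicZp.zpExtension 2).layer 2)) ↥(ℚ⟮θ⟯ ⊔ (CyclotomicZp.zpExtension 2).layer 2) xB) - θ'' + θ'' * (algebraMap (𝓞 ↥(ℚ⟮θ⟯ ⊔ (CyclotomicZp.zpExtension 2).layer 2)) ↥(ℚ⟮θ⟯ ⊔ (CyclotomicZp.zpExtension 2).layer 2) pB) - 2 * θ'' * (algebraMap (𝓞 ↥(ℚ⟮θ⟯ ⊔ (CyclotomicZp.zpExtension 2).layer 2)) ↥(ℚ⟮θ⟯ ⊔ (CyclotomicZp.zpExtension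 2).layer 2) xB) + θ'' * (algebraMap (𝓞 ↥(ℚ⟮θ⟯ ⊔ (CyclotomicZp.zpExtension 2).layer 2)) ↥(ℚ⟮θ⟯ ⊔ (CyclotomicZp.zpExtension 2).layer 2) xB) * (algebraMap (𝓞 ↥(ℚ⟮θ⟯ ⊔ (CyclotomicZp.zpExtension 2).layer 2)) ↥(ℚ⟮θ⟯ ⊔ (CyclotomicZp.zpExtension 2).layer 2) pB) - θ'' ^ 2 * (algebraMap (𝓞 ↥(ℚ⟮θ⟯ ⊔ (CyclotomicZp.zpExtension 2).layer 2)) ↥(ℚ⟮θ⟯ ⊔ (CyclotomicZp.zpExtension 2).layer 2) pB) - θ'' ^ 2 * (algebraMap (𝓞 ↥(ℚ⟮θ⟯ ⊔ (CyclotomicZp.zpExtension 2).layer 2)) ↥(ℚ⟮θ⟯ ⊔ (CyclotomicZp.zpExtension 2).layer 2) xB) * (algebraMap (𝓞 ↥(ℚ⟮θ⟯ ⊔ (CyclotomicZp.zpExtension 2).layer 2)) ↥(ℚ⟮θ⟯ ⊔ (CyclotomicZp.zpExtension 2).layer 2) pB)) := by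
    rw [he₉def, Units.val_mkOfMulEqOne, NumberField.RingOfIntegers.coe_eq_algebraMap]; simp only [map_add, map_sub, map_mul, map_pow, map_zero, map_neg, map_one, map_ofNat, hbB']
  have hve₁₀ : ((e₁₀ : 𝓞 ↥(ℚ⟮θ⟯ ⊔ (CyclotomicZp.zpExtension 2).layer 2)) : ↥(ℚ⟮θ⟯ ⊔ (CyclotomicZp.zpExtension 2).layer 2)) = (1 - 2 * (algebraMap (𝓞 ↥(ℚ⟮θ⟯ ⊔ (CyclotomicZp.zpExtension 2).layer 2)) ↥(ℚ⟮θ⟯ ⊔ (CyclotomicZp.zpExtension 2).layer 2) xB) - θ'' + θ'' * (algebraMap (𝓞 ↥(ℚ⟮θ⟯ ⊔ (CyclotomicZp.zpExtension 2).layer 2)) ↥(ℚ⟮θ⟯ ⊔ (CyclotomicZp.zpExtension 2).layer 2) pB) + 2 * θ'' * (algebraMap (𝓞 ↥(ℚ⟮θ⟯ ⊔ (CyclotomicZp.zpExtension 2).layer 2)) ↥(ℚ⟮θ⟯ ⊔ (CyclotomicZp.zpExtension 2).layer 2) xB) - θ'' ^ 2 * (algebraMap (𝓞 ↥(ℚ⟮θ⟯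 ⊔ (CyclotomicZp.zpExtension 2).layer 2)) ↥(ℚ⟮θ⟯ ⊔ (CyclotomicZp.zpExtension 2).layer 2) pB)) := by
    rw [he₁₀def, Units.val_mkOfMulEqOne, NumberField.RingOfIntegers.coe_eq_algebraMap]; simp only [map_add, map_sub, map_mul, map_pow, map_zero, map_neg, map_one, map_ofNat, hbB']
  have sneg : ∀ (σ : ↥(ℚ⟮θ⟯ ⊔ (CyclotomicZp.zpExtension 2).layer 2) →+* ℝ) (u : (𝓞 ↥(ℚ⟮θ⟯ ⊔ (CyclotomicZp.zpExtension 2).layer 2))ˣ), σ ((u : 𝓞 ↥(ℚ⟮θ⟯ ⊔ (CyclotomicZp.zpExtension 2).layer 2)) : ↥(ℚ⟮θ⟯ ⊔ (CyclotomicZp.zpExtension 2).layer 2)) < 0 → signVec u σ = 1 :=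
    fun σ u h => by rw [signVec_apply, if_pos h]
  have spos : ∀ (σ : ↥(ℚ⟮θ⟯ ⊔ (CyclotomicZp.zpExtension 2).layer 2) →+* ℝ) (u : (𝓞 ↥(ℚ⟮θ⟯ ⊔ (CyclotomicZp.zpExtension 2).layer 2))ˣ), 0 < σ ((u : 𝓞 ↥(ℚ⟮θ⟯ ⊔ (CyclotomicZp.zpExtension 2).layer 2)) : ↥(ℚ⟮θ⟯ ⊔ (CyclotomicZp.zpExtension 2).layer 2)) → signVec u σ = 0 :=
    fun σ u h => by rw [signVec_apply, if_neg (not_lt.mpr h.le)]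
  obtain ⟨τ01p, hτ01pK, hτ01pe⟩ := exists_ringHom_sup_layer_two irreducible_cubic_d469p hθ (isTotallyReal_adjoin_d469p hθ) he he0 ρ₀ (Real.sqrt (2 + Real.sqrt 2)) hrZ1p
  have hτ01pe' : τ01p e'' = (Real.sqrt (2 + Real.sqrt 2)) := hτ01pe; have hτ01pθ : τ01p θ'' = x₀ := by rw [hθ''def, hτ01pK, hρ₀]
  have hτ01pw : τ01p (algebraMap (𝓞 ↥(ℚ⟮θ⟯ ⊔ (CyclotomicZp.zpExtension 2).layer 2)) ↥(ℚ⟮θ⟯ ⊔ (CyclotomicZp.zpExtension 2).layer 2) xB) = ((0) + (Real.sqrt 2) * (-1)) := by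
    rw [hξB']; simp only [map_add, map_sub, map_mul, map_pow, map_zero, map_neg, map_one, map_ofNat, map_div₀, hτ01pθ, hτ01pe']; linear_combination ((-1) / 1) * hZ1sq
  have hτ01pq : τ01p (algebraMap (𝓞 ↥(ℚ⟮θ⟯ ⊔ (CyclotomicZp.zpExtension 2).layer 2)) ↥(ℚ⟮θ⟯ ⊔ (CyclotomicZp.zpExtension 2).layer 2) pB) = (Real.sqrt (2 + Real.sqrt 2)) * ((1) + (Real.sqrt 2) * (0)) := by
    rw [hpB']; simp only [map_add, map_sub, map_mul, map_pow, map_zero, map_neg, map_one, map_ofNat, map_div₀, hτ01pθ, hτ01pe']; linear_combination ((Real.sqrt (2 + Real.sqrt 2)) * (0) / 1) * hZ1sq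
  obtain ⟨sτ01p1, sτ01p2, sτ01p3, sτ01p4, sτ01p5, sτ01p6, sτ01p7, sτ01p8, sτ01p9, sτ01p10⟩ := signsW_r0_Z1pos_d469 τ01p θ'' (algebraMap (𝓞 ↥(ℚ⟮θ⟯ ⊔ (CyclotomicZp.zpExtension 2).layer 2)) ↥(ℚ⟮θ⟯ ⊔ (CyclotomicZp.zpExtension 2).layer 2) xB) (algebraMap (𝓞 ↥(ℚ⟮θ⟯ ⊔ (CyclotomicZp.zpExtension 2).layer 2)) ↥(ℚ⟮θ⟯ ⊔ (CyclotomicZp.zpExtension 2).layer 2) pB) x₀ hτ01pθ hτ01pw hτ01pq (lt_of_eq_of_lt (by norm_num) hl₀) (lt_of_lt_of_eq hu₀ (by norm_num)) hx₀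
  obtain ⟨τ01m, hτ01mK, hτ01me⟩ := exists_ringHom_sup_layer_two irreducible_cubic_d469p hθ (isTotallyReal_adjoin_d469p hθ) he he0 ρ₀ (-Real.sqrt (2 + Real.sqrt 2)) hrZ1m
  have hτ01me' : τ01m e'' = (-Real.sqrt (2 + Real.sqrt 2)) := hτ01me; have hτ01mθ : τ01m θ'' = x₀ := by rw [hθ''def, hτ01mK, hρ₀]
  have hτ01mw : τ01m (algebraMap (𝓞 ↥(ℚ⟮θ⟯ ⊔ (CyclotomicZp.zpExtension 2).layer 2)) ↥(ℚ⟮θ⟯ ⊔ (CyclotomicZp.zpExtension 2).layer 2) xB) = ((0) + (Real.sqrt 2) * (-1)) := by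
    rw [hξB']; simp only [map_add, map_sub, map_mul, map_pow, map_zero, map_neg, map_one, map_ofNat, map_div₀, hτ01mθ, hτ01me']; linear_combination ((-1) / 1) * hZ1sq
  have hτ01mq : τ01m (algebraMap (𝓞 ↥(ℚ⟮θ⟯ ⊔ (CyclotomicZp.zpExtension 2).layer 2)) ↥(ℚ⟮θ⟯ ⊔ (CyclotomicZp.zpExtension 2).layer 2) pB) = (-Real.sqrt (2 + Real.sqrt 2)) * ((1) + (Real.sqrt 2) * (0)) := by
    rw [hpB']; simp only [map_add, map_sub, map_mul, map_pow, map_zero, map_neg, map_one, map_ofNat, map_div₀, hτ01mθ, hτ01me']; linear_combination ((-Real.sqrt (2 + Real.sqrt 2)) * (0) / 1) * hZ1sq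
  obtain ⟨sτ01m1, sτ01m2, sτ01m3, sτ01m4, sτ01m5, sτ01m6, sτ01m7, sτ01m8, sτ01m9, sτ01m10⟩ := signsW_r0_Z1neg_d469 τ01m θ'' (algebraMap (𝓞 ↥(ℚ⟮θ⟯ ⊔ (CyclotomicZp.zpExtension 2).layer 2)) ↥(ℚ⟮θ⟯ ⊔ (CyclotomicZp.zpExtension 2).layer 2) xB) (algebraMap (𝓞 ↥(ℚ⟮θ⟯ ⊔ (CyclotomicZp.zpExtension 2).layer 2)) ↥(ℚ⟮θ⟯ ⊔ (CyclotomicZp.zpExtension 2).layer 2) pB) x₀ hτ01mθ hτ01mw hτ01mq (lt_of_eq_of_lt (by norm_num) hl₀) (lt_of_lt_of_eq hu₀ (by norm_num)) hx₀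
  obtain ⟨τ02p, hτ02pK, hτ02pe⟩ := exists_ringHom_sup_layer_two irreducible_cubic_d469p hθ (isTotallyReal_adjoin_d469p hθ) he he0 ρ₀ (Real.sqrt (2 - Real.sqrt 2)) hrZ2p
  have hτ02pe' : τ02p e'' = (Real.sqrt (2 - Real.sqrt 2)) := hτ02pe; have hτ02pθ : τ02p θ'' = x₀ := by rw [hθ''def, hτ02pK, hρ₀]
  have hτ02pw : τ02p (algebraMap (𝓞 ↥(ℚ⟮θ⟯ ⊔ (CyclotomicZp.zpExtension 2).layer 2)) ↥(ℚ⟮θ⟯ ⊔ (CyclotomicZp.zpExtension 2).layer 2) xB) = ((0) + (-Real.sqrt 2) * (-1)) := by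
    rw [hξB']; simp only [map_add, map_sub, map_mul, map_pow, map_zero, map_neg, map_one, map_ofNat, map_div₀, hτ02pθ, hτ02pe']; linear_combination ((-1) / 1) * hZ2sq
  have hτ02pq : τ02p (algebraMap (𝓞 ↥(ℚ⟮θ⟯ ⊔ (CyclotomicZp.zpExtension 2).layer 2)) ↥(ℚ⟮θ⟯ ⊔ (CyclotomicZp.zpExtension 2).layer 2) pB) = (Real.sqrt (2 - Real.sqrt 2)) * ((1) + (-Real.sqrt 2) * (0)) := by
    rw [hpB']; simp only [map_add, map_sub, map_mul, map_pow, map_zero, map_neg, map_one, map_ofNat, map_div₀, hτ02pθ, hτ02pe']; linear_combination ((Real.sqrt (2 - Real.sqrt 2)) * (0) / 1) * hZ2sq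
  obtain ⟨sτ02p1, sτ02p2, sτ02p3, sτ02p4, sτ02p5, sτ02p6, sτ02p7, sτ02p8, sτ02p9, sτ02p10⟩ := signsW_r0_Z2pos_d469 τ02p θ'' (algebraMap (𝓞 ↥(ℚ⟮θ⟯ ⊔ (CyclotomicZp.zpExtension 2).layer 2)) ↥(ℚ⟮θ⟯ ⊔ (CyclotomicZp.zpExtension 2).layer 2) xB) (algebraMap (𝓞 ↥(ℚ⟮θ⟯ ⊔ (CyclotomicZp.zpExtension 2).layer 2)) ↥(ℚ⟮θ⟯ ⊔ (CyclotomicZp.zpExtension 2).layer 2) pB) x₀ hτ02pθ hτ02pw hτ02pq (lt_of_eq_of_lt (by norm_num) hl₀) (lt_of_lt_of_eq hu₀ (by norm_num)) hx₀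
  obtain ⟨τ02m, hτ02mK, hτ02me⟩ := exists_ringHom_sup_layer_two irreducible_cubic_d469p hθ (isTotallyReal_adjoin_d469p hθ) he he0 ρ₀ (-Real.sqrt (2 - Real.sqrt 2)) hrZ2m
  have hτ02me' : τ02m e'' = (-Real.sqrt (2 - Real.sqrt 2)) := hτ02me; have hτ02mθ : τ02m θ'' = x₀ := by rw [hθ''def, hτ02mK, hρ₀]
  have hτ02mw : τ02m (algebraMap (𝓞 ↥(ℚ⟮θ⟯ ⊔ (CyclotomicZp.zpExtension 2).layer 2)) ↥(ℚ⟮θ⟯ ⊔ (CyclotomicZp.zpExtension 2).layer 2) xB) = ((0) + (-Real.sqrt 2) * (-1)) := by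
    rw [hξB']; simp only [map_add, map_sub, map_mul, map_pow, map_zero, map_neg, map_one, map_ofNat, map_div₀, hτ02mθ, hτ02me']; linear_combination ((-1) / 1) * hZ2sq
  have hτ02mq : τ02m (algebraMap (𝓞 ↥(ℚ⟮θ⟯ ⊔ (CyclotomicZp.zpExtension 2).layer 2)) ↥(ℚ⟮θ⟯ ⊔ (CyclotomicZp.zpExtension 2).layer 2) pB) = (-Real.sqrt (2 - Real.sqrt 2)) * ((1) + (-Real.sqrt 2) * (0)) := by
    rw [hpB']; simp only [map_add, map_sub, map_mul, map_pow, map_zero, map_neg, map_one, map_ofNat, map_div₀, hτ02mθ, hτ02me']; linear_combination ((-Real.sqrt (2 - Real.sqrt 2)) * (0) / 1) * hZ2sq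
  obtain ⟨sτ02m1, sτ02m2, sτ02m3, sτ02m4, sτ02m5, sτ02m6, sτ02m7, sτ02m8, sτ02m9, sτ02m10⟩ := signsW_r0_Z2neg_d469 τ02m θ'' (algebraMap (𝓞 ↥(ℚ⟮θ⟯ ⊔ (CyclotomicZp.zpExtension 2).layer 2)) ↥(ℚ⟮θ⟯ ⊔ (CyclotomicZp.zpExtension 2).layer 2) xB) (algebraMap (𝓞 ↥(ℚ⟮θ⟯ ⊔ (CyclotomicZp.zpExtension 2).layer 2)) ↥(ℚ⟮θ⟯ ⊔ (CyclotomicZp.zpExtension 2).layer 2) pB) x₀ hτ02mθ hτ02mw hτ02mq (lt_of_eq_of_lt (by norm_num) hl₀) (lt_of_lt_of_eq hu₀ (by norm_num)) hx₀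
  obtain ⟨τ11p, hτ11pK, hτ11pe⟩ := exists_ringHom_sup_layer_two irreducible_cubic_d469p hθ (isTotallyReal_adjoin_d469p hθ) he he0 ρ₁ (Real.sqrt (2 + Real.sqrt 2)) hrZ1p
  have hτ11pe' : τ11p e'' = (Real.sqrt (2 + Real.sqrt 2)) := hτ11pe; have hτ11pθ : τ11p θ'' = x₁ := by rw [hθ''def, hτ11pK, hρ₁]
  have hτ11pw : τ11p (algebraMap (𝓞 ↥(ℚ⟮θ⟯ ⊔ (CyclotomicZp.zpExtension 2).layer 2)) ↥(ℚ⟮θ⟯ ⊔ (CyclotomicZp.zpExtension 2).layer 2) xB) = ((0) + (Real.sqrt 2) * (-1)) := by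
    rw [hξB']; simp only [map_add, map_sub, map_mul, map_pow, map_zero, map_neg, map_one, map_ofNat, map_div₀, hτ11pθ, hτ11pe']; linear_combination ((-1) / 1) * hZ1sq
  have hτ11pq : τ11p (algebraMap (𝓞 ↥(ℚ⟮θ⟯ ⊔ (CyclotomicZp.zpExtension 2).layer 2)) ↥(ℚ⟮θ⟯ ⊔ (CyclotomicZp.zpExtension 2).layer 2) pB) = (Real.sqrt (2 + Real.sqrt 2)) * ((1) + (Real.sqrt 2) * (0)) := by
    rw [hpB']; simp only [map_add, map_sub, map_mul, map_pow, map_zero, map_neg, map_one, map_ofNat, map_div₀, hτ11pθ, hτ11pe']; linear_combination ((Real.sqrt (2 + Real.sqrt 2)) * (0) / 1) * hZ1sq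
  obtain ⟨sτ11p1, sτ11p2, sτ11p3, sτ11p4, sτ11p5, sτ11p6, sτ11p7, sτ11p8, sτ11p9, sτ11p10⟩ := signsW_r1_Z1pos_d469 τ11p θ'' (algebraMap (𝓞 ↥(ℚ⟮θ⟯ ⊔ (CyclotomicZp.zpExtension 2).layer 2)) ↥(ℚ⟮θ⟯ ⊔ (CyclotomicZp.zpExtension 2).layer 2) xB) (algebraMap (𝓞 ↥(ℚ⟮θ⟯ ⊔ (CyclotomicZp.zpExtension 2).layer 2)) ↥(ℚ⟮θ⟯ ⊔ (CyclotomicZp.zpExtension 2).layer 2) pB) x₁ hτ11pθ hτ11pw hτ11pq (lt_of_eq_of_lt (by norm_num) hl₁) (lt_of_lt_of_eq hu₁ (by norm_num)) hx₁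
  obtain ⟨τ11m, hτ11mK, hτ11me⟩ := exists_ringHom_sup_layer_two irreducible_cubic_d469p hθ (isTotallyReal_adjoin_d469p hθ) he he0 ρ₁ (-Real.sqrt (2 + Real.sqrt 2)) hrZ1m
  have hτ11me' : τ11m e'' = (-Real.sqrt (2 + Real.sqrt 2)) := hτ11me; have hτ11mθ : τ11m θ'' = x₁ := by rw [hθ''def, hτ11mK, hρ₁]
  have hτ11mw : τ11m (algebraMap (𝓞 ↥(ℚ⟮θ⟯ ⊔ (CyclotomicZp.zpExtension 2).layer 2)) ↥(ℚ⟮θ⟯ ⊔ (CyclotomicZp.zpExtension 2).layer 2) xB) = ((0) + (Real.sqrt 2) * (-1)) := by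
    rw [hξB']; simp only [map_add, map_sub, map_mul, map_pow, map_zero, map_neg, map_one, map_ofNat, map_div₀, hτ11mθ, hτ11me']; linear_combination ((-1) / 1) * hZ1sq
  have hτ11mq : τ11m (algebraMap (𝓞 ↥(ℚ⟮θ⟯ ⊔ (CyclotomicZp.zpExtension 2).layer 2)) ↥(ℚ⟮θ⟯ ⊔ (CyclotomicZp.zpExtension 2).layer 2) pB) = (-Real.sqrt (2 + Real.sqrt 2)) * ((1) + (Real.sqrt 2) * (0)) := by
    rw [hpB']; simp only [map_add, map_sub, map_mul, map_pow, map_zero, map_neg, map_one, map_ofNat, map_div₀, hτ11mθ, hτ11me']; linear_combination ((-Real.sqrt (2 + Real.sqrt 2)) * (0) / 1) * hZ1sq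
  obtain ⟨sτ11m1, sτ11m2, sτ11m3, sτ11m4, sτ11m5, sτ11m6, sτ11m7, sτ11m8, sτ11m9, sτ11m10⟩ := signsW_r1_Z1neg_d469 τ11m θ'' (algebraMap (𝓞 ↥(ℚ⟮θ⟯ ⊔ (CyclotomicZp.zpExtension 2).layer 2)) ↥(ℚ⟮θ⟯ ⊔ (CyclotomicZp.zpExtension 2).layer 2) xB) (algebraMap (𝓞 ↥(ℚ⟮θ⟯ ⊔ (CyclotomicZp.zpExtension 2).layer 2)) ↥(ℚ⟮θ⟯ ⊔ (CyclotomicZp.zpExtension 2).layer 2) pB) x₁ hτ11mθ hτ11mw hτ11mq (lt_of_eq_of_lt (by norm_num) hl₁) (lt_of_lt_of_eq hu₁ (by norm_num)) hx₁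
  obtain ⟨τ12p, hτ12pK, hτ12pe⟩ := exists_ringHom_sup_layer_two irreducible_cubic_d469p hθ (isTotallyReal_adjoin_d469p hθ) he he0 ρ₁ (Real.sqrt (2 - Real.sqrt 2)) hrZ2p
  have hτ12pe' : τ12p e'' = (Real.sqrt (2 - Real.sqrt 2)) := hτ12pe; have hτ12pθ : τ12p θ'' = x₁ := by rw [hθ''def, hτ12pK, hρ₁]
  have hτ12pw : τ12p (algebraMap (𝓞 ↥(ℚ⟮θ⟯ ⊔ (CyclotomicZp.zpExtension 2).layer 2)) ↥(ℚ⟮θ⟯ ⊔ (CyclotomicZp.zpExtension 2).layer 2) xB) = ((0) + (-Real.sqrt 2) * (-1)) := by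
    rw [hξB']; simp only [map_add, map_sub, map_mul, map_pow, map_zero, map_neg, map_one, map_ofNat, map_div₀, hτ12pθ, hτ12pe']; linear_combination ((-1) / 1) * hZ2sq
  have hτ12pq : τ12p (algebraMap (𝓞 ↥(ℚ⟮θ⟯ ⊔ (CyclotomicZp.zpExtension 2).layer 2)) ↥(ℚ⟮θ⟯ ⊔ (CyclotomicZp.zpExtension 2).layer 2) pB) = (Real.sqrt (2 - Real.sqrt 2)) * ((1) + (-Real.sqrt 2) * (0)) := by
    rw [hpB']; simp only [map_add, map_sub, map_mul, map_pow, map_zero, map_neg, map_one, map_ofNat, map_div₀, hτ12pθ, hτ12pe']; linear_combination ((Real.sqrt (2 - Real.sqrt 2)) * (0) / 1) * hZ2sq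
  obtain ⟨sτ12p1, sτ12p2, sτ12p3, sτ12p4, sτ12p5, sτ12p6, sτ12p7, sτ12p8, sτ12p9, sτ12p10⟩ := signsW_r1_Z2pos_d469 τ12p θ'' (algebraMap (𝓞 ↥(ℚ⟮θ⟯ ⊔ (CyclotomicZp.zpExtension 2).layer 2)) ↥(ℚ⟮θ⟯ ⊔ (CyclotomicZp.zpExtension 2).layer 2) xB) (algebraMap (𝓞 ↥(ℚ⟮θ⟯ ⊔ (CyclotomicZp.zpExtension 2).layer 2)) ↥(ℚ⟮θ⟯ ⊔ (CyclotomicZp.zpExtension 2).layer 2) pB) x₁ hτ12pθ hτ12pw hτ12pq (lt_of_eq_of_lt (by norm_num) hl₁) (lt_of_lt_of_eq hu₁ (by norm_num)) hx₁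
  obtain ⟨τ12m, hτ12mK, hτ12me⟩ := exists_ringHom_sup_layer_two irreducible_cubic_d469p hθ (isTotallyReal_adjoin_d469p hθ) he he0 ρ₁ (-Real.sqrt (2 - Real.sqrt 2)) hrZ2m
  have hτ12me' : τ12m e'' = (-Real.sqrt (2 - Real.sqrt 2)) := hτ12me; have hτ12mθ : τ12m θ'' = x₁ := by rw [hθ''def, hτ12mK, hρ₁]
  have hτ12mw : τ12m (algebraMap (𝓞 ↥(ℚ⟮θ⟯ ⊔ (CyclotomicZp.zpExtension 2).layer 2)) ↥(ℚ⟮θ⟯ ⊔ (CyclotomicZp.zpExtension 2).layer 2) xB) = ((0) + (-Real.sqrt 2) * (-1)) := by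
    rw [hξB']; simp only [map_add, map_sub, map_mul, map_pow, map_zero, map_neg, map_one, map_ofNat, map_div₀, hτ12mθ, hτ12me']; linear_combination ((-1) / 1) * hZ2sq
  have hτ12mq : τ12m (algebraMap (𝓞 ↥(ℚ⟮θ⟯ ⊔ (CyclotomicZp.zpExtension 2).layer 2)) ↥(ℚ⟮θ⟯ ⊔ (CyclotomicZp.zpExtension 2).layer 2) pB) = (-Real.sqrt (2 - Real.sqrt 2)) * ((1) + (-Real.sqrt 2) * (0)) := by
    rw [hpB']; simp only [map_add, map_sub, map_mul, map_pow, map_zero, map_neg, map_one, map_ofNat, map_div₀, hτ12mθ, hτ12me']; linear_combination ((-Real.sqrt (2 - Real.sqrt 2)) * (0) / 1) * hZ2sq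
  obtain ⟨sτ12m1, sτ12m2, sτ12m3, sτ12m4, sτ12m5, sτ12m6, sτ12m7, sτ12m8, sτ12m9, sτ12m10⟩ := signsW_r1_Z2neg_d469 τ12m θ'' (algebraMap (𝓞 ↥(ℚ⟮θ⟯ ⊔ (CyclotomicZp.zpExtension 2).layer 2)) ↥(ℚ⟮θ⟯ ⊔ (CyclotomicZp.zpExtension 2).layer 2) xB) (algebraMap (𝓞 ↥(ℚ⟮θ⟯ ⊔ (CyclotomicZp.zpExtension 2).layer 2)) ↥(ℚ⟮θ⟯ ⊔ (CyclotomicZp.zpExtension 2).layer 2) pB) x₁ hτ12mθ hτ12mw hτ12mq (lt_of_eq_of_lt (by norm_num) hl₁) (lt_of_lt_of_eq hu₁ (by norm_num)) hx₁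
  obtain ⟨τ21p, hτ21pK, hτ21pe⟩ := exists_ringHom_sup_layer_two irreducible_cubic_d469p hθ (isTotallyReal_adjoin_d469p hθ) he he0 ρ₂ (Real.sqrt (2 + Real.sqrt 2)) hrZ1p
  have hτ21pe' : τ21p e'' = (Real.sqrt (2 + Real.sqrt 2)) := hτ21pe; have hτ21pθ : τ21p θ'' = x₂ := by rw [hθ''def, hτ21pK, hρ₂]
  have hτ21pw : τ21p (algebraMap (𝓞 ↥(ℚ⟮θ⟯ ⊔ (CyclotomicZp.zpExtension 2).layer 2)) ↥(ℚ⟮θ⟯ ⊔ (CyclotomicZp.zpExtension 2).layer 2) xB) = ((0) + (Real.sqrt 2) * (-1)) := by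
    rw [hξB']; simp only [map_add, map_sub, map_mul, map_pow, map_zero, map_neg, map_one, map_ofNat, map_div₀, hτ21pθ, hτ21pe']; linear_combination ((-1) / 1) * hZ1sq
  have hτ21pq : τ21p (algebraMap (𝓞 ↥(ℚ⟮θ⟯ ⊔ (CyclotomicZp.zpExtension 2).layer 2)) ↥(ℚ⟮θ⟯ ⊔ (CyclotomicZp.zpExtension 2).layer 2) pB) = (Real.sqrt (2 + Real.sqrt 2)) * ((1) + (Real.sqrt 2) * (0)) := by
    rw [hpB']; simp only [map_add, map_sub, map_mul, map_pow, map_zero, map_neg, map_one, map_ofNat, map_div₀, hτ21pθ, hτ21pe']; linear_combination ((Real.sqrt (2 + Real.sqrt 2)) * (0) / 1) * hZ1sq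
  obtain ⟨sτ21p1, sτ21p2, sτ21p3, sτ21p4, sτ21p5, sτ21p6, sτ21p7, sτ21p8, sτ21p9, sτ21p10⟩ := signsW_r2_Z1pos_d469 τ21p θ'' (algebraMap (𝓞 ↥(ℚ⟮θ⟯ ⊔ (CyclotomicZp.zpExtension 2).layer 2)) ↥(ℚ⟮θ⟯ ⊔ (CyclotomicZp.zpExtension 2).layer 2) xB) (algebraMap (𝓞 ↥(ℚ⟮θ⟯ ⊔ (CyclotomicZp.zpExtension 2).layer 2)) ↥(ℚ⟮θ⟯ ⊔ (CyclotomicZp.zpExtension 2).layer 2) pB) x₂ hτ21pθ hτ21pw hτ21pq (lt_of_eq_of_lt (by norm_num) hl₂) (lt_of_lt_of_eq hu₂ (by norm_num)) hx₂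
  obtain ⟨τ21m, hτ21mK, hτ21me⟩ := exists_ringHom_sup_layer_two irreducible_cubic_d469p hθ (isTotallyReal_adjoin_d469p hθ) he he0 ρ₂ (-Real.sqrt (2 + Real.sqrt 2)) hrZ1m
  have hτ21me' : τ21m e'' = (-Real.sqrt (2 + Real.sqrt 2)) := hτ21me; have hτ21mθ : τ21m θ'' = x₂ := by rw [hθ''def, hτ21mK, hρ₂]
  have hτ21mw : τ21m (algebraMap (𝓞 ↥(ℚ⟮θ⟯ ⊔ (CyclotomicZp.zpExtension 2).layer 2)) ↥(ℚ⟮θ⟯ ⊔ (CyclotomicZp.zpExtension 2).layer 2) xB) = ((0) + (Real.sqrt 2) * (-1)) := by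
    rw [hξB']; simp only [map_add, map_sub, map_mul, map_pow, map_zero, map_neg, map_one, map_ofNat, map_div₀, hτ21mθ, hτ21me']; linear_combination ((-1) / 1) * hZ1sq
  have hτ21mq : τ21m (algebraMap (𝓞 ↥(ℚ⟮θ⟯ ⊔ (CyclotomicZp.zpExtension 2).layer 2)) ↥(ℚ⟮θ⟯ ⊔ (CyclotomicZp.zpExtension 2).layer 2) pB) = (-Real.sqrt (2 + Real.sqrt 2)) * ((1) + (Real.sqrt 2) * (0)) := by
    rw [hpB']; simp only [map_add, map_sub, map_mul, map_pow, map_zero, map_neg, map_one, map_ofNat, map_div₀, hτ21mθ, hτ21me']; linear_combination ((-Real.sqrt (2 + Real.sqrt 2)) * (0) / 1) * hZ1sq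
  obtain ⟨sτ21m1, sτ21m2, sτ21m3, sτ21m4, sτ21m5, sτ21m6, sτ21m7, sτ21m8, sτ21m9, sτ21m10⟩ := signsW_r2_Z1neg_d469 τ21m θ'' (algebraMap (𝓞 ↥(ℚ⟮θ⟯ ⊔ (CyclotomicZp.zpExtension 2).layer 2)) ↥(ℚ⟮θ⟯ ⊔ (CyclotomicZp.zpExtension 2).layer 2) xB) (algebraMap (𝓞 ↥(ℚ⟮θ⟯ ⊔ (CyclotomicZp.zpExtension 2).layer 2)) ↥(ℚ⟮θ⟯ ⊔ (CyclotomicZp.zpExtension 2).layer 2) pB) x₂ hτ21mθ hτ21mw hτ21mq (lt_of_eq_of_lt (by norm_num) hl₂) (lt_of_lt_of_eq hu₂ (by norm_num)) hx₂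
  obtain ⟨τ22p, hτ22pK, hτ22pe⟩ := exists_ringHom_sup_layer_two irreducible_cubic_d469p hθ (isTotallyReal_adjoin_d469p hθ) he he0 ρ₂ (Real.sqrt (2 - Real.sqrt 2)) hrZ2p
  have hτ22pe' : τ22p e'' = (Real.sqrt (2 - Real.sqrt 2)) := hτ22pe; have hτ22pθ : τ22p θ'' = x₂ := by rw [hθ''def, hτ22pK, hρ₂]
  have hτ22pw : τ22p (algebraMap (𝓞 ↥(ℚ⟮θ⟯ ⊔ (CyclotomicZp.zpExtension 2).layer 2)) ↥(ℚ⟮θ⟯ ⊔ (CyclotomicZp.zpExtension 2).layer 2) xB) = ((0) + (-Real.sqrt 2) * (-1)) := by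
    rw [hξB']; simp only [map_add, map_sub, map_mul, map_pow, map_zero, map_neg, map_one, map_ofNat, map_div₀, hτ22pθ, hτ22pe']; linear_combination ((-1) / 1) * hZ2sq
  have hτ22pq : τ22p (algebraMap (𝓞 ↥(ℚ⟮θ⟯ ⊔ (CyclotomicZp.zpExtension 2).layer 2)) ↥(ℚ⟮θ⟯ ⊔ (CyclotomicZp.zpExtension 2).layer 2) pB) = (Real.sqrt (2 - Real.sqrt 2)) * ((1) + (-Real.sqrt 2) * (0)) := by
    rw [hpB']; simp only [map_add, map_sub, map_mul, map_pow, map_zero, map_neg, map_one, map_ofNat, map_div₀, hτ22pθ, hτ22pe']; linear_combination ((Real.sqrt (2 - Real.sqrt 2)) * (0) / 1) * hZ2sq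
  obtain ⟨sτ22p1, sτ22p2, sτ22p3, sτ22p4, sτ22p5, sτ22p6, sτ22p7, sτ22p8, sτ22p9, sτ22p10⟩ := signsW_r2_Z2pos_d469 τ22p θ'' (algebraMap (𝓞 ↥(ℚ⟮θ⟯ ⊔ (CyclotomicZp.zpExtension 2).layer 2)) ↥(ℚ⟮θ⟯ ⊔ (CyclotomicZp.zpExtension 2).layer 2) xB) (algebraMap (𝓞 ↥(ℚ⟮θ⟯ ⊔ (CyclotomicZp.zpExtension 2).layer 2)) ↥(ℚ⟮θ⟯ ⊔ (CyclotomicZp.zpExtension 2).layer 2) pB) x₂ hτ22pθ hτ22pw hτ22pq (lt_of_eq_of_lt (by norm_num) hl₂) (lt_of_lt_of_eq hu₂ (by norm_num)) hx₂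
  clear_value e₀ e₁ e₂ e₃ e₄ e₅ e₆ e₇ e₈ e₉ e₁₀
  have hs : ∀ i j, signVec (![e₀, e₁, e₂, e₃, e₄, e₅, e₆, e₇, e₈, e₉, e₁₀] i) (![τ01p, τ01m, τ02p, τ02m, τ11p, τ11m, τ12p, τ12m, τ21p, τ21m, τ22p] j) = !![(1 : ZMod 2), 1, 1, 1, 1, 1, 1, 1, 1, 1, 1; 1, 1, 1, 0, 1, 1, 1, 0, 1, 1, 1; 1, 1, 0, 1, 1, 1, 0, 1, 1, 1, 0; 1, 0, 1, 1, 1, 0, 1, 1, 1, 0, 1; 1, 1, 1, 1, 1, 1, 1, 1, 0, 0, 0; 1, 1, 1, 1, 1, 1, 0, 0, 1, 1, 0; 1, 1, 1, 1, 0, 0, 1, 1, 0, 0, 1; 1, 0, 0, 1, 1, 1, 0, 1, 0, 0, 0; 1, 0, 1, 0, 1, 0, 1, 1, 1, 0, 0; 1, 1, 1, 0, 1, 1, 0, 0, 0, 1, 1; 1, 0, 1, 1, 0, 0, 1, 1, 1, 0, 1] i j := by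
    intro i j
    fin_cases i <;> fin_cases j
    · show signVec e₀ τ01p = 1; rw [he₀def, signVec_neg_one]
    · show signVec e₀ τ01m = 1; rw [he₀def, signVec_neg_one]
    · show signVec e₀ τ02p = 1; rw [he₀def, signVec_neg_one]
    · show signVec e₀ τ02m = 1; rw [he₀def, signVec_neg_one]
    · show signVec e₀ τ11p = 1; rw [he₀def, signVec_neg_one]
    · show signVec e₀ τ11m = 1; rw [he₀def, signVec_neg_one]
    · show signVec e₀ τ12p = 1; rw [he₀def, signVec_neg_one]
    · show signVec e₀ τ12m = 1; rw [he₀def, signVec_neg_one]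
    · show signVec e₀ τ21p = 1; rw [he₀def, signVec_neg_one]
    · show signVec e₀ τ21m = 1; rw [he₀def, signVec_neg_one]
    · show signVec e₀ τ22p = 1; rw [he₀def, signVec_neg_one]
    · show signVec e₁ τ01p = 1; exact sneg τ01p e₁ (by rw [hve₁]; exact sτ01p1)
    · show signVec e₁ τ01m = 1; exact sneg τ01m e₁ (by rw [hve₁]; exact sτ01m1)
    · show signVec e₁ τ02p = 1; exact sneg τ02p e₁ (by rw [hve₁]; exact sτ02p1)
    · show signVec e₁ τ02m = 0; exact spos τ02m e₁ (by rw [hve₁]; exact sτ02m1)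
    · show signVec e₁ τ11p = 1; exact sneg τ11p e₁ (by rw [hve₁]; exact sτ11p1)
    · show signVec e₁ τ11m = 1; exact sneg τ11m e₁ (by rw [hve₁]; exact sτ11m1)
    · show signVec e₁ τ12p = 1; exact sneg τ12p e₁ (by rw [hve₁]; exact sτ12p1)
    · show signVec e₁ τ12m = 0; exact spos τ12m e₁ (by rw [hve₁]; exact sτ12m1)
    · show signVec e₁ τ21p = 1; exact sneg τ21p e₁ (by rw [hve₁]; exact sτ21p1)
    · show signVec e₁ τ21m = 1; exact sneg τ21m e₁ (by rw [hve₁]; exact sτ21m1)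
    · show signVec e₁ τ22p = 1; exact sneg τ22p e₁ (by rw [hve₁]; exact sτ22p1)
    · show signVec e₂ τ01p = 1; exact sneg τ01p e₂ (by rw [hve₂]; exact sτ01p2)
    · show signVec e₂ τ01m = 1; exact sneg τ01m e₂ (by rw [hve₂]; exact sτ01m2)
    · show signVec e₂ τ02p = 0; exact spos τ02p e₂ (by rw [hve₂]; exact sτ02p2)
    · show signVec e₂ τ02m = 1; exact sneg τ02m e₂ (by rw [hve₂]; exact sτ02m2)
    · show signVec e₂ τ11p = 1; exact sneg τ11p e₂ (by rw [hve₂]; exact sτ11p2)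
    · show signVec e₂ τ11m = 1; exact sneg τ11m e₂ (by rw [hve₂]; exact sτ11m2)
    · show signVec e₂ τ12p = 0; exact spos τ12p e₂ (by rw [hve₂]; exact sτ12p2)
    · show signVec e₂ τ12m = 1; exact sneg τ12m e₂ (by rw [hve₂]; exact sτ12m2)
    · show signVec e₂ τ21p = 1; exact sneg τ21p e₂ (by rw [hve₂]; exact sτ21p2)
    · show signVec e₂ τ21m = 1; exact sneg τ21m e₂ (by rw [hve₂]; exact sτ21m2)
    · show signVec e₂ τ22p = 0; exact spos τ22p e₂ (by rw [hve₂]; exact sτ22p2)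
    · show signVec e₃ τ01p = 1; exact sneg τ01p e₃ (by rw [hve₃]; exact sτ01p3)
    · show signVec e₃ τ01m = 0; exact spos τ01m e₃ (by rw [hve₃]; exact sτ01m3)
    · show signVec e₃ τ02p = 1; exact sneg τ02p e₃ (by rw [hve₃]; exact sτ02p3)
    · show signVec e₃ τ02m = 1; exact sneg τ02m e₃ (by rw [hve₃]; exact sτ02m3)
    · show signVec e₃ τ11p = 1; exact sneg τ11p e₃ (by rw [hve₃]; exact sτ11p3)
    · show signVec e₃ τ11m = 0; exact spos τ11m e₃ (by rw [hve₃]; exact sτ11m3)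
    · show signVec e₃ τ12p = 1; exact sneg τ12p e₃ (by rw [hve₃]; exact sτ12p3)
    · show signVec e₃ τ12m = 1; exact sneg τ12m e₃ (by rw [hve₃]; exact sτ12m3)
    · show signVec e₃ τ21p = 1; exact sneg τ21p e₃ (by rw [hve₃]; exact sτ21p3)
    · show signVec e₃ τ21m = 0; exact spos τ21m e₃ (by rw [hve₃]; exact sτ21m3)
    · show signVec e₃ τ22p = 1; exact sneg τ22p e₃ (by rw [hve₃]; exact sτ22p3)
    · show signVec e₄ τ01p = 1; exact sneg τ01p e₄ (by rw [hve₄]; exact sτ01p4)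
    · show signVec e₄ τ01m = 1; exact sneg τ01m e₄ (by rw [hve₄]; exact sτ01m4)
    · show signVec e₄ τ02p = 1; exact sneg τ02p e₄ (by rw [hve₄]; exact sτ02p4)
    · show signVec e₄ τ02m = 1; exact sneg τ02m e₄ (by rw [hve₄]; exact sτ02m4)
    · show signVec e₄ τ11p = 1; exact sneg τ11p e₄ (by rw [hve₄]; exact sτ11p4)
    · show signVec e₄ τ11m = 1; exact sneg τ11m e₄ (by rw [hve₄]; exact sτ11m4)
    · show signVec e₄ τ12p = 1; exact sneg τ12p e₄ (by rw [hve₄]; exact sτ12p4)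
    · show signVec e₄ τ12m = 1; exact sneg τ12m e₄ (by rw [hve₄]; exact sτ12m4)
    · show signVec e₄ τ21p = 0; exact spos τ21p e₄ (by rw [hve₄]; exact sτ21p4)
    · show signVec e₄ τ21m = 0; exact spos τ21m e₄ (by rw [hve₄]; exact sτ21m4)
    · show signVec e₄ τ22p = 0; exact spos τ22p e₄ (by rw [hve₄]; exact sτ22p4)
    · show signVec e₅ τ01p = 1; exact sneg τ01p e₅ (by rw [hve₅]; exact sτ01p5)
    · show signVec e₅ τ01m = 1; exact sneg τ01m e₅ (by rw [hve₅]; exact sτ01m5)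
    · show signVec e₅ τ02p = 1; exact sneg τ02p e₅ (by rw [hve₅]; exact sτ02p5)
    · show signVec e₅ τ02m = 1; exact sneg τ02m e₅ (by rw [hve₅]; exact sτ02m5)
    · show signVec e₅ τ11p = 1; exact sneg τ11p e₅ (by rw [hve₅]; exact sτ11p5)
    · show signVec e₅ τ11m = 1; exact sneg τ11m e₅ (by rw [hve₅]; exact sτ11m5)
    · show signVec e₅ τ12p = 0; exact spos τ12p e₅ (by rw [hve₅]; exact sτ12p5)
    · show signVec e₅ τ12m = 0; exact spos τ12m e₅ (by rw [hve₅]; exact sτ12m5)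
    · show signVec e₅ τ21p = 1; exact sneg τ21p e₅ (by rw [hve₅]; exact sτ21p5)
    · show signVec e₅ τ21m = 1; exact sneg τ21m e₅ (by rw [hve₅]; exact sτ21m5)
    · show signVec e₅ τ22p = 0; exact spos τ22p e₅ (by rw [hve₅]; exact sτ22p5)
    · show signVec e₆ τ01p = 1; exact sneg τ01p e₆ (by rw [hve₆]; exact sτ01p6)
    · show signVec e₆ τ01m = 1; exact sneg τ01m e₆ (by rw [hve₆]; exact sτ01m6)
    · show signVec e₆ τ02p = 1; exact sneg τ02p e₆ (by rw [hve₆]; exact sτ02p6)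
    · show signVec e₆ τ02m = 1; exact sneg τ02m e₆ (by rw [hve₆]; exact sτ02m6)
    · show signVec e₆ τ11p = 0; exact spos τ11p e₆ (by rw [hve₆]; exact sτ11p6)
    · show signVec e₆ τ11m = 0; exact spos τ11m e₆ (by rw [hve₆]; exact sτ11m6)
    · show signVec e₆ τ12p = 1; exact sneg τ12p e₆ (by rw [hve₆]; exact sτ12p6)
    · show signVec e₆ τ12m = 1; exact sneg τ12m e₆ (by rw [hve₆]; exact sτ12m6)
    · show signVec e₆ τ21p = 0; exact spos τ21p e₆ (by rw [hve₆]; exact sτ21p6)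
    · show signVec e₆ τ21m = 0; exact spos τ21m e₆ (by rw [hve₆]; exact sτ21m6)
    · show signVec e₆ τ22p = 1; exact sneg τ22p e₆ (by rw [hve₆]; exact sτ22p6)
    · show signVec e₇ τ01p = 1; exact sneg τ01p e₇ (by rw [hve₇]; exact sτ01p7)
    · show signVec e₇ τ01m = 0; exact spos τ01m e₇ (by rw [hve₇]; exact sτ01m7)
    · show signVec e₇ τ02p = 0; exact spos τ02p e₇ (by rw [hve₇]; exact sτ02p7)
    · show signVec e₇ τ02m = 1; exact sneg τ02m e₇ (by rw [hve₇]; exact sτ02m7)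
    · show signVec e₇ τ11p = 1; exact sneg τ11p e₇ (by rw [hve₇]; exact sτ11p7)
    · show signVec e₇ τ11m = 1; exact sneg τ11m e₇ (by rw [hve₇]; exact sτ11m7)
    · show signVec e₇ τ12p = 0; exact spos τ12p e₇ (by rw [hve₇]; exact sτ12p7)
    · show signVec e₇ τ12m = 1; exact sneg τ12m e₇ (by rw [hve₇]; exact sτ12m7)
    · show signVec e₇ τ21p = 0; exact spos τ21p e₇ (by rw [hve₇]; exact sτ21p7)
    · show signVec e₇ τ21m = 0; exact spos τ21m e₇ (by rw [hve₇]; exact sτ21m7)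
    · show signVec e₇ τ22p = 0; exact spos τ22p e₇ (by rw [hve₇]; exact sτ22p7)
    · show signVec e₈ τ01p = 1; exact sneg τ01p e₈ (by rw [hve₈]; exact sτ01p8)
    · show signVec e₈ τ01m = 0; exact spos τ01m e₈ (by rw [hve₈]; exact sτ01m8)
    · show signVec e₈ τ02p = 1; exact sneg τ02p e₈ (by rw [hve₈]; exact sτ02p8)
    · show signVec e₈ τ02m = 0; exact spos τ02m e₈ (by rw [hve₈]; exact sτ02m8)
    · show signVec e₈ τ11p = 1; exact sneg τ11p e₈ (by rw [hve₈]; exact sτ11p8)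
    · show signVec e₈ τ11m = 0; exact spos τ11m e₈ (by rw [hve₈]; exact sτ11m8)
    · show signVec e₈ τ12p = 1; exact sneg τ12p e₈ (by rw [hve₈]; exact sτ12p8)
    · show signVec e₈ τ12m = 1; exact sneg τ12m e₈ (by rw [hve₈]; exact sτ12m8)
    · show signVec e₈ τ21p = 1; exact sneg τ21p e₈ (by rw [hve₈]; exact sτ21p8)
    · show signVec e₈ τ21m = 0; exact spos τ21m e₈ (by rw [hve₈]; exact sτ21m8)
    · show signVec e₈ τ22p = 0; exact spos τ22p e₈ (by rw [hve₈]; exact sτ22p8)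
    · show signVec e₉ τ01p = 1; exact sneg τ01p e₉ (by rw [hve₉]; exact sτ01p9)
    · show signVec e₉ τ01m = 1; exact sneg τ01m e₉ (by rw [hve₉]; exact sτ01m9)
    · show signVec e₉ τ02p = 1; exact sneg τ02p e₉ (by rw [hve₉]; exact sτ02p9)
    · show signVec e₉ τ02m = 0; exact spos τ02m e₉ (by rw [hve₉]; exact sτ02m9)
    · show signVec e₉ τ11p = 1; exact sneg τ11p e₉ (by rw [hve₉]; exact sτ11p9)
    · show signVec e₉ τ11m = 1; exact sneg τ11m e₉ (by rw [hve₉]; exact sτ11m9)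
    · show signVec e₉ τ12p = 0; exact spos τ12p e₉ (by rw [hve₉]; exact sτ12p9)
    · show signVec e₉ τ12m = 0; exact spos τ12m e₉ (by rw [hve₉]; exact sτ12m9)
    · show signVec e₉ τ21p = 0; exact spos τ21p e₉ (by rw [hve₉]; exact sτ21p9)
    · show signVec e₉ τ21m = 1; exact sneg τ21m e₉ (by rw [hve₉]; exact sτ21m9)
    · show signVec e₉ τ22p = 1; exact sneg τ22p e₉ (by rw [hve₉]; exact sτ22p9)
    · show signVec e₁₀ τ01p = 1; exact sneg τ01p e₁₀ (by rw [hve₁₀]; exact sτ01p10)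
    · show signVec e₁₀ τ01m = 0; exact spos τ01m e₁₀ (by rw [hve₁₀]; exact sτ01m10)
    · show signVec e₁₀ τ02p = 1; exact sneg τ02p e₁₀ (by rw [hve₁₀]; exact sτ02p10)
    · show signVec e₁₀ τ02m = 1; exact sneg τ02m e₁₀ (by rw [hve₁₀]; exact sτ02m10)
    · show signVec e₁₀ τ11p = 0; exact spos τ11p e₁₀ (by rw [hve₁₀]; exact sτ11p10)
    · show signVec e₁₀ τ11m = 0; exact spos τ11m e₁₀ (by rw [hve₁₀]; exact sτ11m10)
    · show signVec e₁₀ τ12p = 1; exact sneg τ12p e₁₀ (by rw [hve₁₀]; exact sτ12p10)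
    · show signVec e₁₀ τ12m = 1; exact sneg τ12m e₁₀ (by rw [hve₁₀]; exact sτ12m10)
    · show signVec e₁₀ τ21p = 1; exact sneg τ21p e₁₀ (by rw [hve₁₀]; exact sτ21p10)
    · show signVec e₁₀ τ21m = 0; exact spos τ21m e₁₀ (by rw [hve₁₀]; exact sτ21m10)
    · show signVec e₁₀ τ22p = 1; exact sneg τ22p e₁₀ (by rw [hve₁₀]; exact sτ22p10)
  have hdet : IsUnit (!![(1 : ZMod 2), 1, 1, 1, 1, 1, 1, 1, 1, 1, 1; 1, 1, 1, 0, 1, 1, 1, 0, 1, 1, 1; 1, 1, 0, 1, 1, 1, 0, 1, 1, 1, 0; 1, 0, 1, 1, 1, 0, 1, 1, 1, 0, 1; 1, 1, 1, 1, 1, 1, 1, 1, 0, 0, 0; 1, 1, 1, 1, 1, 1, 0, 0, 1, 1, 0; 1, 1, 1, 1, 0, 0, 1, 1, 0, 0, 1; 1, 0, 0, 1, 1, 1, 0, 1, 0, 0, 0; 1, 0, 1, 0, 1, 0, 1, 1, 1, 0, 0; 1, 1, 1, 0, 1, 1, 0, 0, 0, 1, 1; 1, 0, 1, 1, 0, 0,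 1, 1, 1, 0, 1]) := by
    have hmul : Matrix.mulᵣ (!![(1 : ZMod 2), 1, 1, 1, 1, 1, 1, 1, 1, 1, 1; 1, 1, 1, 0, 1, 1, 1, 0, 1, 1, 1; 1, 1, 0, 1, 1, 1, 0, 1, 1, 1, 0; 1, 0, 1, 1, 1, 0, 1, 1, 1, 0, 1; 1, 1, 1, 1, 1, 1, 1, 1, 0, 0, 0; 1, 1, 1, 1, 1, 1, 0, 0, 1, 1, 0; 1, 1, 1, 1, 0, 0, 1, 1, 0, 0, 1; 1, 0, 0, 1, 1, 1, 0, 1, 0, 0, 0; 1, 0, 1, 0, 1, 0, 1, 1, 1, 0, 0; 1, 1, 1, 0, 1, 1, 0, 0, 0, 1, 1; 1, 0, 1, 1, 0, 0, 1, 1, 1, 0, 1]) (!![(0 : ZMod 2), 1, 1, 1, 0, 1, 0, 0, 1, 1, 1; 0, 0, 0, 1, 0, 1, 1, 0, 1, 1, 1; 0, 1, 0, 0, 1, 0, 1, 1, 0, 1, 1; 1, 0, 1, 0, 1, 1, 1, 1, 0, 1, 1; 0, 0, 0, 1, 0, 0, 0, 0, 0, 0, 1; 1, 0, 1, 0, 0,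 1, 0, 1, 1, 1, 0; 0, 1, 0, 1, 0, 1, 0, 0, 1, 0, 0; 0, 1, 1, 0, 1, 1, 1, 1, 0, 1, 1; 0, 0, 0, 1, 0, 1, 0, 0, 1, 1, 0; 0, 0, 1, 0, 0, 0, 1, 1, 0, 0, 1; 1, 0, 1, 1, 1, 1, 1, 1, 1, 1, 1]) = 1 := by decide
    rw [Matrix.mulᵣ_eq] at hmul
    haveI := invertibleOfRightInverse _ _ hmul
    exact isUnit_of_invertible _
  have hsig := two_pow_le_card_range_signVec ![e₀, e₁, e₂, e₃, e₄, e₅, e₆, e₇, e₈, e₉, e₁₀] ![τ01p, τ01m, τ02p, τ02m, τ11p, τ11m, τ12p, τ12m, τ21p, τ21m, τ22p] _ hs hdet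
  -- the door
  have hlow : 2 ^ 1 ≤ Nat.card (TotPosUnitsModSq ↥(ℚ⟮θ⟯ ⊔ (CyclotomicZp.zpExtension 2).layer 1)) := by
    rw [pow_one]; exact two_le_card_totPosUnitsModSq_adjoin_sup_layer_one_d469 hθ
  exact index_range_pow_two_narrowClassGroup_eq_of_bounds_of_le h12 (odd_classNumber_adjoin_sup_layer_one_d469 hθ)
    (odd_classNumber_adjoin_sup_layer_two_d469 hθ) (a := 1) (b := 11) (by rw [hfin2]) hlow hsig

end Summit.BirchSwinnertonDyer.BirchSwinnertonDyer.Theorems.AddKatoTwo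

end
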